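import Literature.Computability.AlgebraicComplexity.BI17DegreeExponentMonoidProofs
import Literature.Computability.AlgebraicComplexity.BI17ChowPowerSumPolystableProofs
import HarnessLib

/-!
# Bürgisser–Ikenmeyer 2017, Prop. 3.25 (`e(X_1⋯X_m) ≥ m`, equality iff Alon–Tarsi) — discharge

P. Bürgisser, C. Ikenmeyer, *Fundamental invariants of orbit closures*, J. Algebra **477** (2017)
390–434 = arXiv:1511.02927 [BurgisserIkenmeyer2017], §3.3 Prop. 3.25 (`\label{pro:ps-pr-expr}`,
`main.tex` L1411–1434; held text `paper:arxiv-1511.02927`, p0013): "Let `m` be even. Then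
`e(X_1⋯X_m) ≥ m` and equality holds iff the Alon-Tarsi conjecture is true for `m`" (an observation
due to Kumar 2015 and Kumar–Landsberg 2015). Theorem-only companion of the file of record
`BI17FundamentalInvariantForms.lean` (val-lit row BI17-A, t04), which types it as the named fact
`BI2017_prop_3_25` with AT(m) rendered as `Kumar2015.latinColCount m ≠ 0`.

The printed proof, followed verbatim: "By Theorem 3.15 it is sufficient to show that `P_{m,m}`
evaluated at `X_1⋯X_m` is nonzero iff the Alon-Tarsi conjecture holds for `m`" — Thm. 3.15 is the
tree's `BI2017_thm_3_15_holds` (`BI17DegreeExponentMonoidProofs.lean`, val-lit t09), applied to the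
polystable (`isPolystable_prod_X`, `BI17ChowPowerSumPolystableProofs.lean`) form `X_1⋯X_m` of even
degree `D = m`; and "If we interpret `σ_1,…,σ_m` as the columns of the matrix `T(i,j) = σ_i(j)`, then
we get a nonzero contribution iff `T` is a latin square … Therefore `P_{m,m}(w_m)` equals the
difference of the column-even and the column-odd latin squares" — here with the normalisation of
the symmetric array `w_m = (1/m!) ∑_π |π(1)⋯π(m)⟩` (L1424) made explicit:
`(m!)^m · P_{m,m}(X_1⋯X_m) = latinColCount m` (`aeval_formCoeff_prod_X_cayleyP`).

* `wordExp_eq_wordExp_id_iff`, `coeff_wordExp_prod_X`, `card_filter_wordExp_eq_wordExp_id`,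
  `arrOf_prod_X` — the symmetric array of `X_1⋯X_m` is `1/m!` on bijective words, `0` elsewhere.
* `aeval_formCoeff_prod_X_cayleyP` — `(m!)^m P_{m,m}(X_1⋯X_m) = ♯CELS(m) − ♯COLS(m)` (any field of
  characteristic zero).
* `BI2017_prop_3_25_holds` — **Prop. 3.25 DISCHARGED**.

No new definitions; no facts introduced. Honest framing: a statement about the minimal degree of
the Chow form `X_1⋯X_m`; nothing here bears on VP versus VNP, and AT(m) itself is not proved.

## References

* [BurgisserIkenmeyer2017] P. Bürgisser, C. Ikenmeyer, *Fundamental invariants of orbit closures*,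
  J. Algebra 477 (2017) 390–434; arXiv:1511.02927, §3.3 Prop. 3.25 (with Thm. 3.15, eq. (3.5)).
* [Kumar2015] S. Kumar, *A study of the representations supported by the orbit closure of the
  determinant*, Compositio Math. 151 (2015), §4 (column-signed Latin squares).
-/

open MvPolynomial

namespace Literature.Computability.AlgebraicComplexity

section ChowArray

variable {k : Type*} [Field k] {m : ℕ}

/-- A word `J : [m] → [m]` has the content `x_1⋯x_m` of the identity word iff it is a permutation.
[cite: BurgisserIkenmeyer2017, Prop. 3.25 (proof: "`w(μ_1,…,μ_m)` is nonzero iff `μ` is a permutation of `[m]`")] -/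
theorem wordExp_eq_wordExp_id_iff (J : Fin m → Fin m) :
    wordExp J = wordExp (id : Fin m → Fin m) ↔ Function.Bijective J := by
  constructor
  · intro h
    obtain ⟨π, hπ⟩ := exists_comp_perm_eq_of_wordExp_eq h.symm
    rw [← hπ]
    exact Function.bijective_id.comp π.bijective
  · intro h
    rw [show J = id ∘ (Equiv.ofBijective J h) from rfl, wordExp_comp_perm]

open Classical in
/-- The coefficient of the monomial `x_J` in `X_1⋯X_m`: `1` if `J` is a permutation of `[m]`, `0`
otherwise. [cite: BurgisserIkenmeyer2017, Prop. 3.25 (proof)] -/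
theorem coeff_wordExp_prod_X (J : Fin m → Fin m) :
    coeff (wordExp J) (∏ i : Fin m, X i : MvPolynomial (Fin m) k) =
      if Function.Bijective J then 1 else 0 := by
  have h : (∏ i : Fin m, X i : MvPolynomial (Fin m) k) = monomial (wordExp (id : Fin m → Fin m)) 1 :=
    prod_X_eq_monomial_wordExp (k := k) id
  rw [h, coeff_monomial]
  by_cases hJ : Function.Bijective J
  · rw [if_pos ((wordExp_eq_wordExp_id_iff J).mpr hJ).symm, if_pos hJ]
  · rw [if_neg (fun h' => hJ ((wordExp_eq_wordExp_id_iff J).mp h'.symm)), if_neg hJ]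

/-- The number of words with content `x_1⋯x_m` is `m!` (the permutations of `[m]`; the `1/m!` of
BI 2017 L1424). [cite: BurgisserIkenmeyer2017, Prop. 3.25 (proof)] -/
theorem card_filter_wordExp_eq_wordExp_id :
    (Finset.univ.filter fun I : Fin m → Fin m => wordExp I = wordExp (id : Fin m → Fin m)).card =
      Nat.factorial m := by
  classical
  have hset : (Finset.univ.filter fun I : Fin m → Fin m => wordExp I = wordExp (id : Fin m → Fin m)) =
      Finset.univ.map ⟨fun π : Equiv.Perm (Fin m) => (⇑π : Fin m → Fin m),
        Equiv.coe_fn_injective⟩ := by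
    ext I
    simp only [Finset.mem_filter, Finset.mem_univ, true_and, Finset.mem_map,
      Function.Embedding.coeFn_mk]
    rw [wordExp_eq_wordExp_id_iff]
    exact ⟨fun h => ⟨Equiv.ofBijective I h, rfl⟩, fun ⟨π, hπ⟩ => hπ ▸ π.bijective⟩
  rw [hset, Finset.card_map, Finset.card_univ, Fintype.card_perm, Fintype.card_fin]

open Classical in
/-- **The symmetric array of `X_1⋯X_m`** is `w_m = (1/m!) ∑_{π ∈ S_m} |π(1)⋯π(m)⟩` (BI 2017 L1424):
`1/m!` on permutations, `0` on all other words. [cite: BurgisserIkenmeyer2017, Prop. 3.25 (proof)] -/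
theorem arrOf_prod_X (J : Fin m → Fin m) :
    arrOf m (∏ i : Fin m, X i : MvPolynomial (Fin m) k) J =
      if Function.Bijective J then ((Nat.factorial m : k))⁻¹ else 0 := by
  rw [arrOf, coeff_wordExp_prod_X]
  split_ifs with hJ
  · rw [(wordExp_eq_wordExp_id_iff J).mpr hJ, card_filter_wordExp_eq_wordExp_id, one_div]
  · rw [zero_div]

/-- A product of `if P i then c else 0` is `c^n` if all `P i` hold and `0` otherwise. [folklore] -/
private theorem prod_ite_const_zero {ι : Type*} [Fintype ι] (P : ι → Prop) [DecidablePred P]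
    (c : k) : (∏ i, if P i then c else 0) = if ∀ i, P i then c ^ Fintype.card ι else 0 := by
  split_ifs with h
  · rw [Finset.prod_congr rfl fun i _ => if_pos (h i), Finset.prod_const, Finset.card_univ]
  · obtain ⟨i, hi⟩ := not_forall.mp h
    exact Finset.prod_eq_zero (Finset.mem_univ i) (if_neg hi)

open Classical in
/-- **`(m!)^m · P_{m,m}(X_1⋯X_m) = ♯CELS(m) − ♯COLS(m)`** (BI 2017, proof of Prop. 3.25, L1422–1431):
in Cayley's hyperdeterminant `∑_{σ_1,…,σ_m} (∏ sgn σ_j) ∏_i w_m(σ_1(i),…,σ_m(i))` evaluated at the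
array `w_m` of `X_1⋯X_m`, "we get a nonzero contribution iff `T` [the square with columns `σ_j`]
is a latin square", each contributing its column sign times `(1/m!)^m`; hence the value is the
column-signed count of Latin squares, `Kumar2015.latinColCount m`, over `(m!)^m`.
[cite: BurgisserIkenmeyer2017, Prop. 3.25 (proof)] -/
theorem aeval_formCoeff_prod_X_cayleyP [CharZero k] (m : ℕ) :
    (Nat.factorial m : k) ^ m *
        aeval (formCoeff m (∏ i : Fin m, X i : MvPolynomial (Fin m) k))
          (cayleyP (k := k) m (Equiv.refl (Fin m))) =
      (Kumar2015.latinColCount m : k) := by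
  rw [cayleyP, aeval_formCoeff_hyperdetPoly]
  simp only [Equiv.coe_refl, Function.id_comp]
  unfold hyperdet
  simp_rw [arrOf_prod_X, prod_ite_const_zero, Fintype.card_fin, mul_ite, mul_zero]
  rw [← Finset.sum_filter, ← Finset.sum_mul, ← mul_assoc, mul_comm ((Nat.factorial m : k) ^ m),
    mul_assoc, ← mul_pow, mul_inv_cancel₀ (Nat.cast_ne_zero.mpr (Nat.factorial_ne_zero m)),
    one_pow, mul_one]
  -- reindex: tuples of column permutations with bijective rows ↔ Latin squares
  rw [Kumar2015.latinColCount, Int.cast_sum]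
  refine Finset.sum_bij' (fun σ _ => fun p j => σ j p)
    (fun R hR => fun j => Equiv.ofBijective (fun p => R p j)
      (Finite.injective_iff_bijective.mp ((Finset.mem_filter.mp hR).2.2 j)))
    ?_ ?_ ?_ ?_ ?_
  · intro σ hσ
    refine Finset.mem_filter.mpr ⟨Finset.mem_univ _, fun p => (Finset.mem_filter.mp hσ).2 p,
      fun j => (σ j).injective⟩
  · intro R hR
    exact Finset.mem_filter.mpr ⟨Finset.mem_univ _, fun p => (Finset.mem_filter.mp hR).2.1 p⟩
  · intro σ _
    funext j
    exact Equiv.ext fun p => rfl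
  · intro R _
    rfl
  · intro σ _
    rw [Kumar2015.rectColSign, Units.coe_prod, Int.cast_prod]
    refine Finset.prod_congr rfl fun j _ => ?_
    rw [show (fun p => σ j p) = ⇑(σ j) from rfl, Kumar2015.seqSign_coe_perm]

end ChowArray

/-! ### The discharge -/

/-- **BI 2017, Prop. 3.25 DISCHARGED**: for even `m ≥ 2`, `m ≤ e(X_1⋯X_m)`, with equality iff
`AT(m)` (`Kumar2015.latinColCount m ≠ 0`). Printed proof: Thm. 3.15 (`BI2017_thm_3_15_holds`) for
the polystable form `X_1⋯X_m` (`isPolystable_prod_X`) of even degree `m` gives `m ≤ e` and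
`e = m ↔ P_{m,m}(X_1⋯X_m) ≠ 0`, and `(m!)^m P_{m,m}(X_1⋯X_m) = latinColCount m`
(`aeval_formCoeff_prod_X_cayleyP`). [cite: BurgisserIkenmeyer2017, Prop. 3.25] -/
theorem BI2017_prop_3_25_holds : BI2017_prop_3_25 := by
  intro m hm h2
  have hhom : (∏ i : Fin m, X i : MvPolynomial (Fin m) ℂ).IsHomogeneous m := by
    rw [show (∏ i : Fin m, X i : MvPolynomial (Fin m) ℂ) = monomial (wordExp (id : Fin m → Fin m)) 1
      from prod_X_eq_monomial_wordExp (k := ℂ) id]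
    exact isHomogeneous_monomial _ (degree_wordExp _)
  have hne : (∏ i : Fin m, X i : MvPolynomial (Fin m) ℂ) ≠ 0 := by
    rw [show (∏ i : Fin m, X i : MvPolynomial (Fin m) ℂ) = monomial (wordExp (id : Fin m → Fin m)) 1
      from prod_X_eq_monomial_wordExp (k := ℂ) id]
    exact monomial_eq_zero.not.mpr one_ne_zero
  obtain ⟨hle, -, heven, -⟩ :=
    BI2017_thm_3_15_holds m m (∏ i : Fin m, X i) h2 h2 hhom hne (isPolystable_prod_X m)
  refine ⟨hle, ?_⟩
  rw [heven hm]
  have key := aeval_formCoeff_prod_X_cayleyP (k := ℂ) m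
  have hfact : ((Nat.factorial m : ℂ)) ^ m ≠ 0 :=
    pow_ne_zero _ (Nat.cast_ne_zero.mpr (Nat.factorial_ne_zero m))
  constructor
  · intro hP hL
    rw [hL, Int.cast_zero] at key
    exact hP ((mul_eq_zero.mp key).resolve_left hfact)
  · intro hL hP
    rw [hP, mul_zero] at key
    exact hL (by exact_mod_cast key.symm)

end Literature.Computability.AlgebraicComplexity
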